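import Literature.MathematicalPhysics.QuantumLattice.WilsonBlockHeatBathMarkov
import Mathlib.MeasureTheory.Function.ConditionalExpectation.CondexpL2
import Mathlib.MeasureTheory.Function.ConditionalExpectation.Real
import Mathlib.Analysis.InnerProductSpace.Adjoint
import HarnessLib

/-!
# The block heat-bath projections of the torus Wilson theory on `L²`

Theorems only.  For a sub-σ-algebra `m'` of a finite measure space, the `L²` conditional expectation
`E_{m'} = ι ∘ condExpL2` (Mathlib `MeasureTheory.condExpL2` followed by the inclusion of the `m'`-measurable classes)
is the orthogonal projection of `L²(μ)` onto the closed subspace of `m'`-measurable classes (`heatBathProj_props`: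
self-adjoint, idempotent, fixing exactly its range), nested σ-algebras give `E₂ E₁ = E₁ = E₁ E₂` (`heatBathProj_comp`,
the tower property), `E_{m'} f` is a version of `μ[f | m']` (`heatBathProj_ae_eq_condExp`), and squared `L²` norms are
integrals of squares (`norm_sq_eq_integral_sq`).  For the torus Wilson state `μ = wilsonMeasure ρ β` and the exterior
σ-algebras `𝓕_{B_zᶜ}` of the overlapping blocks (`WilsonBlockHeatBath.lean`) these are the block heat-bath projections
`E_z`, and **heat-bath projections of far blocks commute**: `E_z E_w = E_w E_z` whenever the block indices differ
cyclically by more than `2` in some axis (`heatBathProj_commute_of_far`) — both products are the projection onto the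
classes measurable for the links off both blocks, by the Markov property
(`aestronglyMeasurable_condExp_extSigma_far`) on bounded functions and the density of simple functions in `L²`
(Martinelli 1999 §3: the block heat-bath kernels of a finite-range Gibbs field at distance larger than the range
commute).

References: F. Martinelli, *Lectures on Glauber dynamics for discrete spin models*, LNM 1717 (1999), §3.
-/

noncomputable section

open scoped InnerProductSpace
open MeasureTheory Filter
open Literature.MathematicalPhysics.QuantumFieldTheory

namespace Literature.MathematicalPhysics.QuantumLattice.WilsonBlockHeatBath

/-! ### Block heat-bath projections on `L²` -/

section L2

/-- The `L²` conditional expectation onto a sub-σ-algebra, viewed as an operator of `L²`, is the orthogonal projection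
onto the `m'`-measurable classes: self-adjoint, idempotent, with range the `m'`-measurable classes, which it fixes.
[folklore] -/
theorem heatBathProj_props {Ω : Type*} {m' m0 : MeasurableSpace Ω} {μ : Measure Ω}
    [IsFiniteMeasure μ] (hm' : m' ≤ m0) :
    IsSelfAdjoint ((lpMeas ℝ ℝ m' 2 μ).subtypeL ∘L condExpL2 ℝ ℝ hm') ∧
    ((lpMeas ℝ ℝ m' 2 μ).subtypeL ∘L condExpL2 ℝ ℝ hm') * ((lpMeas ℝ ℝ m' 2 μ).subtypeL ∘L condExpL2 ℝ ℝ hm') =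
      (lpMeas ℝ ℝ m' 2 μ).subtypeL ∘L condExpL2 ℝ ℝ hm' ∧
    (∀ f : Lp ℝ 2 μ, ((lpMeas ℝ ℝ m' 2 μ).subtypeL ∘L condExpL2 ℝ ℝ hm') f ∈ lpMeas ℝ ℝ m' 2 μ) ∧
    (∀ f : Lp ℝ 2 μ, f ∈ lpMeas ℝ ℝ m' 2 μ → ((lpMeas ℝ ℝ m' 2 μ).subtypeL ∘L condExpL2 ℝ ℝ hm') f = f) := by
  haveI : Fact (m' ≤ m0) := ⟨hm'⟩
  have h : ((lpMeas ℝ ℝ m' 2 μ).subtypeL ∘L condExpL2 ℝ ℝ hm' : Lp ℝ 2 μ →L[ℝ] Lp ℝ 2 μ) =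
      (lpMeas ℝ ℝ m' 2 μ).starProjection := rfl
  rw [h]
  exact ⟨isSelfAdjoint_starProjection _, (Submodule.isIdempotentElem_starProjection _).eq,
    fun f => Submodule.starProjection_apply_mem _ f, fun f hf => Submodule.starProjection_eq_self_iff.2 hf⟩

/-- Nested conditioning (tower property in `L²`): for `m₁ ≤ m₂` the projections satisfy `E₂ E₁ = E₁ = E₁ E₂`.
[folklore] -/
theorem heatBathProj_comp {Ω : Type*} {m₁ m₂ m0 : MeasurableSpace Ω} {μ : Measure Ω}
    [IsFiniteMeasure μ] (hm₁ : m₁ ≤ m0) (hm₂ : m₂ ≤ m0) (h12 : m₁ ≤ m₂) :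
    ((lpMeas ℝ ℝ m₂ 2 μ).subtypeL ∘L condExpL2 ℝ ℝ hm₂) * ((lpMeas ℝ ℝ m₁ 2 μ).subtypeL ∘L condExpL2 ℝ ℝ hm₁) =
      (lpMeas ℝ ℝ m₁ 2 μ).subtypeL ∘L condExpL2 ℝ ℝ hm₁ ∧
    ((lpMeas ℝ ℝ m₁ 2 μ).subtypeL ∘L condExpL2 ℝ ℝ hm₁) * ((lpMeas ℝ ℝ m₂ 2 μ).subtypeL ∘L condExpL2 ℝ ℝ hm₂) =
      (lpMeas ℝ ℝ m₁ 2 μ).subtypeL ∘L condExpL2 ℝ ℝ hm₁ := by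
  haveI : Fact (m₁ ≤ m0) := ⟨hm₁⟩
  haveI : Fact (m₂ ≤ m0) := ⟨hm₂⟩
  have hle : lpMeas ℝ ℝ m₁ 2 μ ≤ lpMeas ℝ ℝ m₂ 2 μ := fun f hf =>
    mem_lpMeas_iff_aestronglyMeasurable.2 ((mem_lpMeas_iff_aestronglyMeasurable.1 hf).mono h12)
  have h₁ : ((lpMeas ℝ ℝ m₁ 2 μ).subtypeL ∘L condExpL2 ℝ ℝ hm₁ : Lp ℝ 2 μ →L[ℝ] Lp ℝ 2 μ) =
      (lpMeas ℝ ℝ m₁ 2 μ).starProjection := rfl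
  have h₂ : ((lpMeas ℝ ℝ m₂ 2 μ).subtypeL ∘L condExpL2 ℝ ℝ hm₂ : Lp ℝ 2 μ →L[ℝ] Lp ℝ 2 μ) =
      (lpMeas ℝ ℝ m₂ 2 μ).starProjection := rfl
  rw [h₁, h₂]
  refine ⟨ContinuousLinearMap.ext fun f => ?_, ?_⟩
  · rw [mul_apply_eq_comp]
    exact Submodule.starProjection_eq_self_iff.2 (hle (Submodule.starProjection_apply_mem _ f))
  · rw [ContinuousLinearMap.mul_def]; exact Submodule.starProjection_comp_starProjection_of_le hle

/-- The `L²` projection of a class `f` is a version of the conditional expectation `μ[f | m']`. [folklore] -/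
theorem heatBathProj_ae_eq_condExp {Ω : Type*} {m' m0 : MeasurableSpace Ω} {μ : Measure Ω}
    [IsFiniteMeasure μ] (hm' : m' ≤ m0) (f : Lp ℝ 2 μ) :
    ((((lpMeas ℝ ℝ m' 2 μ).subtypeL ∘L condExpL2 ℝ ℝ hm') f : Lp ℝ 2 μ) : Ω → ℝ) =ᵐ[μ] μ[(f : Ω → ℝ) | m'] := by
  have := (Lp.memLp f).condExpL2_ae_eq_condExp (E := ℝ) (𝕜 := ℝ) hm'
  rw [Lp.toLp_coeFn] at this
  exact this

/-- The squared `L²` norm of a class is the integral of the square of any representative. [folklore] -/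
theorem norm_sq_eq_integral_sq {Ω : Type*} {m0 : MeasurableSpace Ω} {μ : Measure Ω} (f : Lp ℝ 2 μ)
    {F : Ω → ℝ} (hfF : (f : Ω → ℝ) =ᵐ[μ] F) :
    ‖f‖ ^ 2 = ∫ x, (F x) ^ 2 ∂μ := by
  rw [← real_inner_self_eq_norm_sq, MeasureTheory.L2.inner_def]
  refine integral_congr_ae (hfF.mono fun x hx => ?_)
  simp only [hx, real_inner_self_eq_norm_sq, Real.norm_eq_abs, sq_abs]

end L2

/-! ### The Markov property as a commutation of projections -/

section Markov

variable {G : Type} [Group G] [TopologicalSpace G] [IsTopologicalGroup G] [CompactSpace G] [MeasurableSpace G]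
  [BorelSpace G] [T2Space G] [SecondCountableTopology G] {Nρ : ℕ} (ρ : G →* Matrix (Fin Nρ) (Fin Nρ) ℂ)
  {N : ℕ} [NeZero N]

/-- The cyclic index distance `|i − j|` around `ℤ/M` is symmetric. [folklore] -/
theorem natAbs_valMinAbs_sub_comm {M : ℕ} (i j : ZMod M) :
    ((i - j).valMinAbs).natAbs = ((j - i).valMinAbs).natAbs := by
  rw [← neg_sub, ZMod.natAbs_valMinAbs_neg]

/-- **Block heat-bath projections of far blocks commute** (Martinelli 1999 §3): for block indices at cyclic distance
`> 2` in some axis, `E_z E_w = E_{zw} = E_w E_z` on `L²(μ)`, where `E_{zw}` conditions on the links off both blocks —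
the Markov property `aestronglyMeasurable_condExp_extSigma_far` on bounded functions, extended by density.
[cite: Martinelli1999, §3] -/
theorem heatBathProj_commute_of_far (hρ : Continuous ρ) (β : ℝ) {m : ℕ} [NeZero m] (hmN : m ≤ N)
    {z w : Fin 4 → Fin m} (hfar : ∃ k, 2 < ((((z k : ℕ) : ZMod m) - ((w k : ℕ) : ZMod m)).valMinAbs).natAbs) :
    ((lpMeas ℝ ℝ (extSigma G N m z) 2 (wilsonMeasure (d := 4) (L := N) ρ β)).subtypeL ∘L
        condExpL2 ℝ ℝ (linkSigma_le _)) *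
      ((lpMeas ℝ ℝ (extSigma G N m w) 2 (wilsonMeasure (d := 4) (L := N) ρ β)).subtypeL ∘L
        condExpL2 ℝ ℝ (linkSigma_le _)) =
    ((lpMeas ℝ ℝ (extSigma G N m w) 2 (wilsonMeasure (d := 4) (L := N) ρ β)).subtypeL ∘L
        condExpL2 ℝ ℝ (linkSigma_le _)) *
      ((lpMeas ℝ ℝ (extSigma G N m z) 2 (wilsonMeasure (d := 4) (L := N) ρ β)).subtypeL ∘L
        condExpL2 ℝ ℝ (linkSigma_le _)) := by
  haveI := isProbabilityMeasure_wilsonMeasure (d := 4) (L := N) (G := G) ρ hρ β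
  set μ := wilsonMeasure (d := 4) (L := N) ρ β with hμ
  -- the projection of a link set
  set Pr : Set (Edge 4 N) → (Lp ℝ 2 μ →L[ℝ] Lp ℝ 2 μ) := fun S =>
    (lpMeas ℝ ℝ (linkSigma (G := G) S) 2 μ).subtypeL ∘L condExpL2 ℝ ℝ (linkSigma_le S) with hPr
  have key : ∀ (z w : Fin 4 → Fin m) (T : Set (Edge 4 N)),
      T = {e | ¬ InBlock N m z e.1 ∧ ¬ InBlock N m w e.1} →
      (∃ k, 2 < ((((z k : ℕ) : ZMod m) - ((w k : ℕ) : ZMod m)).valMinAbs).natAbs) →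
      Pr {e | ¬ InBlock N m z e.1} * Pr {e | ¬ InBlock N m w e.1} = Pr T := by
    intro z w T hT hzw
    have hTz : linkSigma (G := G) T ≤ linkSigma {e | ¬ InBlock N m z e.1} :=
      linkSigma_mono fun e he => (hT ▸ he).1
    have hTw : linkSigma (G := G) T ≤ linkSigma {e | ¬ InBlock N m w e.1} :=
      linkSigma_mono fun e he => (hT ▸ he).2
    obtain ⟨-, -, hTmem, hTfix⟩ := heatBathProj_props (μ := μ) (linkSigma_le (G := G) T)
    -- Claim: the range of `E_z E_w` is `𝓕_T`-measurable
    have hC : ∀ f : Lp ℝ 2 μ,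
        Pr {e | ¬ InBlock N m z e.1} (Pr {e | ¬ InBlock N m w e.1} f) ∈ lpMeas ℝ ℝ (linkSigma (G := G) T) 2 μ := by
      -- bounded measurable representatives
      have hbdd : ∀ f : Lp ℝ 2 μ, (∃ F : GaugeConfig 4 N G → ℝ, Measurable F ∧ (∃ B, ∀ U, |F U| ≤ B) ∧
          (f : GaugeConfig 4 N G → ℝ) =ᵐ[μ] F) →
          Pr {e | ¬ InBlock N m z e.1} (Pr {e | ¬ InBlock N m w e.1} f) ∈ lpMeas ℝ ℝ (linkSigma (G := G) T) 2 μ := by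
        rintro f ⟨F, hFm, ⟨B, hB⟩, hfF⟩
        obtain ⟨F₁, hF₁m, hF₁b, hF₁dep, hF₁ae⟩ :=
          exists_version_condExp_linkSigma (N := N) ρ β {e | ¬ InBlock N m w e.1} hB
        have h1 : ((Pr {e | ¬ InBlock N m w e.1} f : Lp ℝ 2 μ) : GaugeConfig 4 N G → ℝ) =ᵐ[μ] F₁ :=
          (heatBathProj_ae_eq_condExp _ f).trans ((condExp_congr_ae hfF).trans hF₁ae.symm)
        have h2 := (heatBathProj_ae_eq_condExp (μ := μ) (linkSigma_le {e | ¬ InBlock N m z e.1})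
          (Pr {e | ¬ InBlock N m w e.1} f)).trans (condExp_congr_ae h1)
        have h3 := aestronglyMeasurable_condExp_extSigma_far ρ hρ β hmN (z := z) (w := w) hzw hF₁m hF₁b hF₁dep
        rw [← hT] at h3
        exact mem_lpMeas_iff_aestronglyMeasurable.2 (h3.congr h2.symm)
      -- density of simple functions
      have hclosed : IsClosed {f : Lp ℝ 2 μ |
          Pr T (Pr {e | ¬ InBlock N m z e.1} (Pr {e | ¬ InBlock N m w e.1} f)) =
            Pr {e | ¬ InBlock N m z e.1} (Pr {e | ¬ InBlock N m w e.1} f)} :=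
        isClosed_eq ((Pr T).continuous.comp ((Pr _).continuous.comp (Pr _).continuous))
          ((Pr _).continuous.comp (Pr _).continuous)
      have hsub : Set.range ((↑) : Lp.simpleFunc ℝ 2 μ → Lp ℝ 2 μ) ⊆ {f : Lp ℝ 2 μ |
          Pr T (Pr {e | ¬ InBlock N m z e.1} (Pr {e | ¬ InBlock N m w e.1} f)) =
            Pr {e | ¬ InBlock N m z e.1} (Pr {e | ¬ InBlock N m w e.1} f)} := by
        rintro _ ⟨s, rfl⟩
        refine hTfix _ (hbdd _ ⟨Lp.simpleFunc.toSimpleFunc s, (Lp.simpleFunc.toSimpleFunc s).measurable, ?_,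
          (Lp.simpleFunc.toSimpleFunc_eq_toFun s).symm⟩)
        obtain ⟨C, hC⟩ := (Lp.simpleFunc.toSimpleFunc s).exists_forall_norm_le
        exact ⟨C, fun U => by rw [← Real.norm_eq_abs]; exact hC U⟩
      have hdense := (Lp.simpleFunc.denseRange (E := ℝ) (p := 2) (μ := μ) ENNReal.ofNat_ne_top).closure_eq
      intro f
      have hall := hclosed.closure_subset_iff.2 hsub
      rw [hdense] at hall
      have hf : Pr T (Pr {e | ¬ InBlock N m z e.1} (Pr {e | ¬ InBlock N m w e.1} f)) =
          Pr {e | ¬ InBlock N m z e.1} (Pr {e | ¬ InBlock N m w e.1} f) := hall (Set.mem_univ f)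
      rw [← hf]
      exact hTmem _
    -- conclude `E_z E_w = E_T`
    have hz := (heatBathProj_comp (μ := μ) (linkSigma_le (G := G) T)
      (linkSigma_le {e | ¬ InBlock N m z e.1}) hTz).2
    have hw := (heatBathProj_comp (μ := μ) (linkSigma_le (G := G) T)
      (linkSigma_le {e | ¬ InBlock N m w e.1}) hTw).2
    refine ContinuousLinearMap.ext fun f => ?_
    have e1 : Pr {e | ¬ InBlock N m z e.1} (Pr {e | ¬ InBlock N m w e.1} f) =
        Pr T (Pr {e | ¬ InBlock N m z e.1} (Pr {e | ¬ InBlock N m w e.1} f)) := (hTfix _ (hC f)).symm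
    have e2 : Pr T (Pr {e | ¬ InBlock N m z e.1} (Pr {e | ¬ InBlock N m w e.1} f)) =
        Pr T (Pr {e | ¬ InBlock N m w e.1} f) := by
      have := congrArg (fun A : Lp ℝ 2 μ →L[ℝ] Lp ℝ 2 μ => A (Pr {e | ¬ InBlock N m w e.1} f)) hz
      simpa only [mul_apply_eq_comp] using this
    have e3 : Pr T (Pr {e | ¬ InBlock N m w e.1} f) = Pr T f := by
      have := congrArg (fun A : Lp ℝ 2 μ →L[ℝ] Lp ℝ 2 μ => A f) hw
      simpa only [mul_apply_eq_comp] using this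
    rw [mul_apply_eq_comp, e1, e2, e3]
  have hwz : ∃ k, 2 < ((((w k : ℕ) : ZMod m) - ((z k : ℕ) : ZMod m)).valMinAbs).natAbs := by
    obtain ⟨k, hk⟩ := hfar; exact ⟨k, by rwa [natAbs_valMinAbs_sub_comm]⟩
  have h1 := key z w {e | ¬ InBlock N m z e.1 ∧ ¬ InBlock N m w e.1} rfl hfar
  have h2 := key w z {e | ¬ InBlock N m z e.1 ∧ ¬ InBlock N m w e.1} (Set.ext fun e => and_comm) hwz
  exact h1.trans h2.symm

end Markov

end Literature.MathematicalPhysics.QuantumLattice.WilsonBlockHeatBath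

end
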